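import Summits.AtomisticToContinuum.FouriersLaw.Theorems.RobinCoercivity.Negative.SchurPositivity
import Summits.AtomisticToContinuum.FouriersLaw.Theorems.HonestZwanzigRobinCoercivityContactBlock

/-!
# `HonestZwanzig.RobinCoercivity` (crux stmt-AtomisticToContinuum-12695) — the even/odd decomposition of `ξᵀ𝔽_N(s)ξ`

Refuter / crux-disprover support file (`--supports stmt-AtomisticToContinuum-12695`; structural helper, modulo the fixed-`N`
package `hFI` = route item `FeshbachIdentities`, gadgets as in `…Negative.SchurPositivity`). For a profile `ξ` put
`g_ξ := Σ_x ξ_x L e_x = j_ξ + w_ξ` with the ODD part `j_ξ = Σ_x ξ_x (j_{x−1} − j_x)` (`= Σ_b (ξ_{b+1} − ξ_b) j_b`, the bond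
currents weighted by the discrete gradient) and the EVEN part `w_ξ = γ ξ_0 (T − p_0²) + γ ξ_{N−1} (T − p_{N−1}²)` (bath
heating at the contacts); then `Σ_x ξ_x L†e_x = −j_ξ + w_ξ` and

  `ξᵀ𝔽_N(s)ξ = s·ξᵀCov(e,e)ξ + γT²(ξ_0² + ξ_{N−1}²) − schur_s(w_ξ, w_ξ) − 2·schur_s(w_ξ, j_ξ) + schur_s(j_ξ, j_ξ)`

(`feshbach_quadratic_decomposition`; time reversal gives `schur_s(j_ξ, w_ξ) = −schur_s(w_ξ, j_ξ)`). Consequences for the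
provers (see the crux's `Disproof.lean`): `schur_s(w_ξ,w_ξ), schur_s(j_ξ,j_ξ) ≥ 0` (`schur_self_nonneg`) so the contact
conductance is RENORMALISED DOWN (`≤ γT²`, the contact ceiling) and the bulk term is the bond-current memory form
`(∇ξ)ᵀ𝔎_N(s)(∇ξ)`; but the even–odd CROSS MEMORY `schur_s(w_ξ, j_ξ)` is NOT controlled by any positivity (the joint Schur Gram
matrix of `(w_ξ, j_ξ)` is `[[a, b], [−b, d]]`, whose symmetric part ignores `b`): a split "bulk ellipticity of `𝔎_N` +
contact margin ⇒ RobinCoercivity" must ALSO bound `b`.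
-/

noncomputable section

open MeasureTheory Finset Matrix
open Literature.MathematicalPhysics.KineticTheory.HeatConduction
open Summit.AtomisticToContinuum.FouriersLaw.Theses.HonestZwanzig
open Summit.AtomisticToContinuum.FouriersLaw.Theorems.HonestZwanzig
open Summit.AtomisticToContinuum.FouriersLaw.Theorems.HonestZwanzig.NetworkReduction

namespace Summit.AtomisticToContinuum.FouriersLaw.Theorems.RobinCoercivity.Negative

section FixedN

variable {ω₂ lam β γ : ℝ} {N : ℕ} {T : ℝ}
  {Adm : (PhaseSpace N → ℝ) → Prop}
  {corr : (PhaseSpace N → ℝ) → (PhaseSpace N → ℝ) → ℝ → ℝ}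
  {lap : ℝ → (PhaseSpace N → ℝ) → (PhaseSpace N → ℝ) → ℝ}
  {cov : (PhaseSpace N → ℝ) → (PhaseSpace N → ℝ) → ℝ}
  {e : Fin N → PhaseSpace N → ℝ}
  (hAdm : ∀ f, Adm f ↔ (Continuous f ∧ ∃ A : ℝ, ∀ z,
    |f z| ≤ A * Real.exp ((pinnedChain ω₂ lam β γ).hamiltonian N z / (8 * T))))
  (hcorr : ∀ f g t, corr f g t =
    (∫ z, f z * (∫ y, g y ∂((pinnedChain ω₂ lam β γ).transitionKernel N T T t.toNNReal z))
      ∂(pinnedChain ω₂ lam β γ).gibbsMeasure N T) -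
    (∫ z, f z ∂(pinnedChain ω₂ lam β γ).gibbsMeasure N T) *
      (∫ z, g z ∂(pinnedChain ω₂ lam β γ).gibbsMeasure N T))
  (hlap : ∀ s f g, lap s f g = ∫ t in Set.Ioi (0 : ℝ), Real.exp (-(s * t)) * corr f g t)
  (hcov : ∀ f g, cov f g = (∫ z, f z * g z ∂(pinnedChain ω₂ lam β γ).gibbsMeasure N T) -
    (∫ z, f z ∂(pinnedChain ω₂ lam β γ).gibbsMeasure N T) *
      (∫ z, g z ∂(pinnedChain ω₂ lam β γ).gibbsMeasure N T))
  (he : ∀ x z, e x z = z.2 x ^ 2 / 2 + (pinnedChain ω₂ lam β γ).U (z.1 x) +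
    ∑ j : Fin N, ((if j.val = x.val + 1 then (pinnedChain ω₂ lam β γ).V (z.1 j - z.1 x) / 2 else 0) +
      (if x.val = j.val + 1 then (pinnedChain ω₂ lam β γ).V (z.1 x - z.1 j) / 2 else 0)))
  (hFI : ∀ f g : PhaseSpace N → ℝ, Adm f → Adm g →
    Integrable f ((pinnedChain ω₂ lam β γ).gibbsMeasure N T) ∧
    (∀ t : ℝ, 0 ≤ t → Integrable (fun z => f z *
      (∫ y, g y ∂((pinnedChain ω₂ lam β γ).transitionKernel N T T t.toNNReal z)))
      ((pinnedChain ω₂ lam β γ).gibbsMeasure N T)) ∧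
    IntegrableOn (corr f g) (Set.Ioi 0) ∧
    (∀ t : ℝ, 0 ≤ t → corr f g t = corr (fun z => g (z.1, -z.2)) (fun z => f (z.1, -z.2)) t) ∧
    (∀ s : ℝ, 0 < s → ∀ x : Fin N,
      s * lap s (e x) g - cov (e x) g =
        lap s (fun z => (pinnedChain ω₂ lam β γ).generator N T T (e x) (z.1, -z.2)) g ∧
      s * lap s f (e x) - cov f (e x) = lap s f ((pinnedChain ω₂ lam β γ).generator N T T (e x))))
  (hGSE : ∀ (x : Fin N) (z : PhaseSpace N), (pinnedChain ω₂ lam β γ).generator N T T (e x) z =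
    (∑ b : Fin N, ((if x.val = b.val + 1 then (pinnedChain ω₂ lam β γ).bondCurrent N b z else 0) -
      (if b = x then (pinnedChain ω₂ lam β γ).bondCurrent N b z else 0))) +
    (if x.val = 0 then (pinnedChain ω₂ lam β γ).γ * (T - z.2 x ^ 2) else 0) +
    (if x.val = N - 1 then (pinnedChain ω₂ lam β γ).γ * (T - z.2 x ^ 2) else 0))
  (hPS : ∀ x y : Fin N, cov (e x) ((pinnedChain ω₂ lam β γ).generator N T T (e y)) =
    -(if x = y ∧ (x.val = 0 ∨ x.val = N - 1) then (pinnedChain ω₂ lam β γ).γ * T ^ 2 else 0))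
  (hω : 0 < ω₂) (hl : 0 ≤ lam) (hβ : 0 ≤ β) (hγ : 0 ≤ γ) (hT : 0 < T)

include hcorr hlap in
/-- `schur_s(f, c·g) = c·schur_s(f, g)` (any matrix `G`; no integrability needed). -/
theorem schur_const_mul_right' (s : ℝ) (G : Matrix (Fin N) (Fin N) ℝ)
    (schur : (PhaseSpace N → ℝ) → (PhaseSpace N → ℝ) → ℝ)
    (hschur : ∀ f g, schur f g = lap s f g - ∑ u, ∑ v, lap s f (e u) * G⁻¹ u v * lap s (e v) g)
    (c : ℝ) (f g : PhaseSpace N → ℝ) : schur f (fun z => c * g z) = c * schur f g := by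
  rw [hschur, hschur]
  simp only [lap_const_mul_right hcorr hlap, mul_sub, Finset.mul_sum]
  congr 1
  exact Finset.sum_congr rfl fun u _ => Finset.sum_congr rfl fun v _ => by ring

include hcorr hlap in
/-- `schur_s(c·f, g) = c·schur_s(f, g)`. -/
theorem schur_const_mul_left' (s : ℝ) (G : Matrix (Fin N) (Fin N) ℝ)
    (schur : (PhaseSpace N → ℝ) → (PhaseSpace N → ℝ) → ℝ)
    (hschur : ∀ f g, schur f g = lap s f g - ∑ u, ∑ v, lap s f (e u) * G⁻¹ u v * lap s (e v) g)
    (c : ℝ) (f g : PhaseSpace N → ℝ) : schur (fun z => c * f z) g = c * schur f g := by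
  rw [hschur, hschur]
  simp only [lap_const_mul_left hcorr hlap, mul_sub, Finset.mul_sum]
  congr 1
  exact Finset.sum_congr rfl fun u _ => Finset.sum_congr rfl fun v _ => by ring

include hAdm hcorr hlap he hFI hω hl hβ hT in
/-- Additivity of the Schur pairing in each slot (admissible observables, `s ≥ 0`). -/
theorem schur_add_add {s : ℝ} (hs : 0 ≤ s) (G : Matrix (Fin N) (Fin N) ℝ)
    (schur : (PhaseSpace N → ℝ) → (PhaseSpace N → ℝ) → ℝ)
    (hschur : ∀ f g, schur f g = lap s f g - ∑ u, ∑ v, lap s f (e u) * G⁻¹ u v * lap s (e v) g)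
    {f₁ f₂ g₁ g₂ : PhaseSpace N → ℝ} (hf₁ : Adm f₁) (hf₂ : Adm f₂) (hg₁ : Adm g₁) (hg₂ : Adm g₂) :
    schur (fun z => f₁ z + f₂ z) (fun z => g₁ z + g₂ z) =
      schur f₁ g₁ + schur f₁ g₂ + schur f₂ g₁ + schur f₂ g₂ := by
  -- two-element families through `sum_sum_schur_eq_schur_sum`
  have h := sum_sum_schur_eq_schur_sum hAdm hcorr hlap he hFI hω hl hβ hT hs G schur hschur Finset.univ Finset.univ
    (fun i : Fin 2 => if i = 0 then f₁ else f₂) (fun k : Fin 2 => if k = 0 then g₁ else g₂)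
    (fun i _ => by fin_cases i <;> simpa) (fun k _ => by fin_cases k <;> simpa)
  simp only [Fin.sum_univ_two, Fin.isValue, show (1 : Fin 2) ≠ 0 from by decide, if_true, if_false] at h
  rw [← h]
  ring

include hAdm hcorr hlap he hFI hω hl hβ hT in
/-- **Time reversal for the Schur pairing of an odd and an even observable**: `schur_s(j, w) = −schur_s(w, j)` when
`j∘Θ = −j`, `w∘Θ = w` and `G = G(s)` (symmetric). -/
theorem schur_odd_even {s : ℝ} (G : Matrix (Fin N) (Fin N) ℝ) (hG : ∀ x y, G x y = lap s (e x) (e y))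
    (schur : (PhaseSpace N → ℝ) → (PhaseSpace N → ℝ) → ℝ)
    (hschur : ∀ f g, schur f g = lap s f g - ∑ u, ∑ v, lap s f (e u) * G⁻¹ u v * lap s (e v) g)
    {j w : PhaseSpace N → ℝ} (hj : Adm j) (hw : Adm w) (hjodd : ∀ z, j (z.1, -z.2) = -j z)
    (hweven : ∀ z, w (z.1, -z.2) = w z) : schur j w = -schur w j := by
  classical
  have hex : ∀ x, Adm (e x) := fun x => adm_e Adm hAdm e he hω hl hβ hT x
  have hjfun : (fun z : PhaseSpace N => j (z.1, -z.2)) = fun z => (-1 : ℝ) * j z := funext fun z => by rw [hjodd]; ring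
  have hwfun : (fun z : PhaseSpace N => w (z.1, -z.2)) = w := funext hweven
  have hefun : ∀ u, (fun z : PhaseSpace N => e u (z.1, -z.2)) = e u := fun u => funext fun z => e_neg_momentum _ e he u z
  have h1 : lap s j w = -lap s w j := by
    rw [lap_rev hlap hFI hj hw, hwfun, hjfun, lap_const_mul_right hcorr hlap]; ring
  have h2 : ∀ u, lap s j (e u) = -lap s (e u) j := fun u => by
    rw [lap_rev hlap hFI hj (hex u), hefun, hjfun, lap_const_mul_right hcorr hlap]; ring
  have h3 : ∀ v, lap s (e v) w = lap s w (e v) := fun v => by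
    rw [lap_rev hlap hFI (hex v) hw, hwfun, hefun]
  have hGsym : ∀ x y, G x y = G y x := fun x y => by rw [hG, hG, pkg_G_symm hAdm hlap he hFI hω hl hβ hT s]
  have hGT : Gᵀ = G := transpose_eq_of_symm G hGsym
  have hGinv : ∀ u v, G⁻¹ u v = G⁻¹ v u := fun u v => by
    have := congrFun (congrFun (Matrix.transpose_nonsing_inv G) v) u
    rw [hGT, Matrix.transpose_apply] at this
    exact this
  rw [hschur, hschur, h1]
  simp only [h2, h3]
  rw [Finset.sum_comm]
  have : ∑ y, ∑ x, -lap s (e x) j * G⁻¹ x y * lap s w (e y) = -∑ u, ∑ v, lap s w (e u) * G⁻¹ u v * lap s (e v) j := by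
    rw [← Finset.sum_neg_distrib]
    refine Finset.sum_congr rfl fun u _ => ?_
    rw [← Finset.sum_neg_distrib]
    refine Finset.sum_congr rfl fun v _ => ?_
    rw [hGinv v u]; ring
  rw [this]; ring

include hGSE in
/-- The weighted generator image, pointwise: `Σ_x ξ_x (L e_x)(z) = j_ξ(z) + w_ξ(z)`. -/
theorem sum_mul_generator_splitSite (ξ : Fin N → ℝ) (z : PhaseSpace N) :
    ∑ x, ξ x * (pinnedChain ω₂ lam β γ).generator N T T (e x) z =
      (∑ x, ξ x * ∑ b : Fin N, ((if x.val = b.val + 1 then (pinnedChain ω₂ lam β γ).bondCurrent N b z else 0) -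
        (if b = x then (pinnedChain ω₂ lam β γ).bondCurrent N b z else 0))) +
      ∑ x, ξ x * ((if x.val = 0 then (pinnedChain ω₂ lam β γ).γ * (T - z.2 x ^ 2) else 0) +
        (if x.val = N - 1 then (pinnedChain ω₂ lam β γ).γ * (T - z.2 x ^ 2) else 0)) := by
  rw [← Finset.sum_add_distrib]
  refine Finset.sum_congr rfl fun x _ => ?_
  rw [hGSE]; ring

include hGSE in
/-- The weighted REVERSED generator image, pointwise: `Σ_x ξ_x (L e_x)(q,−p) = −j_ξ(z) + w_ξ(z)`. -/
theorem sum_mul_generator_splitSite_rev (ξ : Fin N → ℝ) (z : PhaseSpace N) :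
    ∑ x, ξ x * (pinnedChain ω₂ lam β γ).generator N T T (e x) (z.1, -z.2) =
      -(∑ x, ξ x * ∑ b : Fin N, ((if x.val = b.val + 1 then (pinnedChain ω₂ lam β γ).bondCurrent N b z else 0) -
        (if b = x then (pinnedChain ω₂ lam β γ).bondCurrent N b z else 0))) +
      ∑ x, ξ x * ((if x.val = 0 then (pinnedChain ω₂ lam β γ).γ * (T - z.2 x ^ 2) else 0) +
        (if x.val = N - 1 then (pinnedChain ω₂ lam β γ).γ * (T - z.2 x ^ 2) else 0)) := by
  rw [← Finset.sum_neg_distrib, ← Finset.sum_add_distrib]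
  refine Finset.sum_congr rfl fun x _ => ?_
  rw [hGSE]
  simp only [OscillatorChain.bondCurrent_neg_momentum, Pi.neg_apply, neg_sq]
  have : ∀ b : Fin N, ((if x.val = b.val + 1 then -(pinnedChain ω₂ lam β γ).bondCurrent N b z else 0) -
      (if b = x then -(pinnedChain ω₂ lam β γ).bondCurrent N b z else 0)) =
      -((if x.val = b.val + 1 then (pinnedChain ω₂ lam β γ).bondCurrent N b z else 0) -
        (if b = x then (pinnedChain ω₂ lam β γ).bondCurrent N b z else 0)) := fun b => by
    split_ifs <;> ring
  simp only [this, Finset.sum_neg_distrib]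
  ring

include hAdm hcorr hlap hFI he hGSE hPS hω hl hβ hT in
/-- **The even/odd decomposition of the Feshbach quadratic form.** For `N ≥ 2`, `s > 0`, the fixed-`N` package and
`G = G(s)`: with the odd observable `j_ξ = Σ_x ξ_x (j_{x−1} − j_x)` and the even one
`w_ξ = γ Σ_x ξ_x ([x=0] + [x=N−1])(T − p_x²)`,
`ξᵀ𝔽ξ = s·ξᵀCov(e,e)ξ + γT²(ξ_0² + ξ_{N−1}²) − schur_s(w_ξ,w_ξ) − 2·schur_s(w_ξ,j_ξ) + schur_s(j_ξ,j_ξ)`. -/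
theorem feshbach_quadratic_decomposition (hN : 2 ≤ N) {s : ℝ} (hs : 0 < s)
    (G : Matrix (Fin N) (Fin N) ℝ) (hG : ∀ x y, G x y = lap s (e x) (e y))
    (schur : (PhaseSpace N → ℝ) → (PhaseSpace N → ℝ) → ℝ)
    (hschur : ∀ f g, schur f g = lap s f g - ∑ u, ∑ v, lap s f (e u) * G⁻¹ u v * lap s (e v) g)
    (F : Fin N → Fin N → ℝ)
    (hF : ∀ x y, F x y = s * cov (e x) (e y) - cov (e x) ((pinnedChain ω₂ lam β γ).generator N T T (e y)) -
      schur (fun z => (pinnedChain ω₂ lam β γ).generator N T T (e x) (z.1, -z.2))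
        ((pinnedChain ω₂ lam β γ).generator N T T (e y)))
    (ξ : Fin N → ℝ) (jξ wξ : PhaseSpace N → ℝ)
    (hj : ∀ z, jξ z = ∑ x, ξ x * ∑ b : Fin N,
      ((if x.val = b.val + 1 then (pinnedChain ω₂ lam β γ).bondCurrent N b z else 0) -
        (if b = x then (pinnedChain ω₂ lam β γ).bondCurrent N b z else 0)))
    (hw : ∀ z, wξ z = ∑ x, ξ x * ((if x.val = 0 then (pinnedChain ω₂ lam β γ).γ * (T - z.2 x ^ 2) else 0) +
      (if x.val = N - 1 then (pinnedChain ω₂ lam β γ).γ * (T - z.2 x ^ 2) else 0))) :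
    ∑ x, ∑ y, ξ x * F x y * ξ y =
      s * (∑ x, ∑ y, ξ x * cov (e x) (e y) * ξ y) +
        (pinnedChain ω₂ lam β γ).γ * T ^ 2 *
          (∑ i : Fin N, ((if i.val = 0 then ξ i ^ 2 else 0) + (if i.val = N - 1 then ξ i ^ 2 else 0))) -
        schur wξ wξ - 2 * schur wξ jξ + schur jξ jξ := by
  have hLf : ∀ x, Adm ((pinnedChain ω₂ lam β γ).generator N T T (e x)) :=
    fun x => adm_generator_e hAdm hGSE hω hl hβ hT x
  have hLr : ∀ x, Adm (fun z => (pinnedChain ω₂ lam β γ).generator N T T (e x) (z.1, -z.2)) :=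
    fun x => adm_rev Adm hAdm (hLf x)
  -- admissibility and parity of `j_ξ`, `w_ξ`
  have hjadm : Adm jξ := by
    refine adm_of_eq Adm hj (adm_sum Adm hAdm Finset.univ _ (adm_const Adm hAdm hω hl hβ hT 0) fun x _ => ?_)
    refine adm_const_mul Adm hAdm _ (adm_sum Adm hAdm Finset.univ _ (adm_const Adm hAdm hω hl hβ hT 0) fun b _ => ?_)
    exact adm_sub Adm hAdm
      (adm_ite Adm _ (adm_bondCurrent Adm hAdm hω hl hβ hT b) (adm_const Adm hAdm hω hl hβ hT 0))
      (adm_ite Adm _ (adm_bondCurrent Adm hAdm hω hl hβ hT b) (adm_const Adm hAdm hω hl hβ hT 0))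
  have hwadm : Adm wξ := by
    refine adm_of_eq Adm hw (adm_sum Adm hAdm Finset.univ _ (adm_const Adm hAdm hω hl hβ hT 0) fun x _ => ?_)
    refine adm_const_mul Adm hAdm _ (adm_add Adm hAdm ?_ ?_)
    · exact adm_ite Adm _ (adm_const_mul Adm hAdm _ (adm_sub Adm hAdm (adm_const Adm hAdm hω hl hβ hT T)
        (adm_psq Adm hAdm hω hl hβ hT x))) (adm_const Adm hAdm hω hl hβ hT 0)
    · exact adm_ite Adm _ (adm_const_mul Adm hAdm _ (adm_sub Adm hAdm (adm_const Adm hAdm hω hl hβ hT T)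
        (adm_psq Adm hAdm hω hl hβ hT x))) (adm_const Adm hAdm hω hl hβ hT 0)
  have hjodd : ∀ z, jξ (z.1, -z.2) = -jξ z := fun z => by
    rw [hj, hj, ← Finset.sum_neg_distrib]
    refine Finset.sum_congr rfl fun x _ => ?_
    rw [← mul_neg, ← Finset.sum_neg_distrib]
    congr 1
    refine Finset.sum_congr rfl fun b _ => ?_
    simp only [OscillatorChain.bondCurrent_neg_momentum]
    split_ifs <;> ring
  have hweven : ∀ z, wξ (z.1, -z.2) = wξ z := fun z => by
    rw [hw, hw]
    simp only [Pi.neg_apply, neg_sq]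
  -- the weighted generator images
  have hgsum : (fun z => ∑ y, ξ y * (pinnedChain ω₂ lam β γ).generator N T T (e y) z) = fun z => jξ z + wξ z := by
    funext z; rw [sum_mul_generator_splitSite hGSE ξ z, hj, hw]
  have hfsum : (fun z => ∑ x, ξ x * (pinnedChain ω₂ lam β γ).generator N T T (e x) (z.1, -z.2)) =
      fun z => (-1 : ℝ) * jξ z + wξ z := by
    funext z; rw [sum_mul_generator_splitSite_rev hGSE ξ z, hj, hw]; ring
  -- (1) the Schur block
  have hS : ∑ x, ∑ y, ξ x * schur (fun z => (pinnedChain ω₂ lam β γ).generator N T T (e x) (z.1, -z.2))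
      ((pinnedChain ω₂ lam β γ).generator N T T (e y)) * ξ y =
      -schur jξ jξ - schur jξ wξ + schur wξ jξ + schur wξ wξ := by
    have h1 : ∀ x y, ξ x * schur (fun z => (pinnedChain ω₂ lam β γ).generator N T T (e x) (z.1, -z.2))
        ((pinnedChain ω₂ lam β γ).generator N T T (e y)) * ξ y =
        schur (fun z => ξ x * (pinnedChain ω₂ lam β γ).generator N T T (e x) (z.1, -z.2))
          (fun z => ξ y * (pinnedChain ω₂ lam β γ).generator N T T (e y) z) := fun x y => by
      rw [schur_const_mul_left' hcorr hlap s G schur hschur, schur_const_mul_right' hcorr hlap s G schur hschur]; ring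
    simp only [h1]
    rw [sum_sum_schur_eq_schur_sum hAdm hcorr hlap he hFI hω hl hβ hT hs.le G schur hschur Finset.univ Finset.univ
      (fun x z => ξ x * (pinnedChain ω₂ lam β γ).generator N T T (e x) (z.1, -z.2))
      (fun y z => ξ y * (pinnedChain ω₂ lam β γ).generator N T T (e y) z)
      (fun x _ => adm_const_mul Adm hAdm _ (hLr x)) (fun y _ => adm_const_mul Adm hAdm _ (hLf y)), hfsum, hgsum,
      schur_add_add hAdm hcorr hlap he hFI hω hl hβ hT hs.le G schur hschur (adm_const_mul Adm hAdm _ hjadm) hwadm hjadm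
        hwadm, schur_const_mul_left' hcorr hlap s G schur hschur, schur_const_mul_left' hcorr hlap s G schur hschur]
    ring
  have hodd := schur_odd_even hAdm hcorr hlap he hFI hω hl hβ hT G hG schur hschur hjadm hwadm hjodd hweven
  -- (2) the static block
  have hC : ∑ x, ∑ y, ξ x * cov (e x) ((pinnedChain ω₂ lam β γ).generator N T T (e y)) * ξ y =
      -((pinnedChain ω₂ lam β γ).γ * T ^ 2) *
        ∑ i : Fin N, ((if i.val = 0 then ξ i ^ 2 else 0) + (if i.val = N - 1 then ξ i ^ 2 else 0)) := by
    rw [← sum_sum_neg_ite_diag_boundary hN ((pinnedChain ω₂ lam β γ).γ * T ^ 2) ξ]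
    exact Finset.sum_congr rfl fun x _ => Finset.sum_congr rfl fun y _ => by rw [hPS]
  -- assemble
  have hsplit : ∑ x, ∑ y, ξ x * F x y * ξ y = s * (∑ x, ∑ y, ξ x * cov (e x) (e y) * ξ y) -
      ∑ x, ∑ y, ξ x * cov (e x) ((pinnedChain ω₂ lam β γ).generator N T T (e y)) * ξ y -
      ∑ x, ∑ y, ξ x * schur (fun z => (pinnedChain ω₂ lam β γ).generator N T T (e x) (z.1, -z.2))
        ((pinnedChain ω₂ lam β γ).generator N T T (e y)) * ξ y := by
    simp only [hF, Finset.mul_sum, ← Finset.sum_sub_distrib]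
    exact Finset.sum_congr rfl fun x _ => Finset.sum_congr rfl fun y _ => by ring
  rw [hsplit, hC, hS, hodd]
  ring

end FixedN

end Summit.AtomisticToContinuum.FouriersLaw.Theorems.RobinCoercivity.Negative

end
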